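import Literature.AnabelianGeometry.EtaleTheta.Discharge.Sec4NonVacuityThm44
import HarnessLib

/-!
# [EtTh] Prop 4.2 (iii) is INDEPENDENT of the §4 setting axioms: a kernel countermodel (the toy)

S. Mochizuki, *The étale theta function and its Frobenioid-theoretic manifestations*, Publ. RIMS **45**
(2009) [MochizukiEtTh2009], §4, Prop 4.2 (iii) p.88 (PDF): "there exist … an `N`-th root of the
fraction-pair".  Its printed proof (p.89 L77–80) passes to a tempered COVERING of `X^log` over which `f`
acquires an `N`-th root (the step recorded as sub-node L01a `RootOverCovering` of
`plan/L2/SUBDAG-EtTh-Prop42.md`, where the author's ERRATUM E2 — tempered-meromorphic functions,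
[IUTchI] Rmk 3.2.4 — enters).

This PROOF-ONLY file (no definitions) shows in the kernel that this step CANNOT be dispensed with at the
level of the typed interfaces: the perfect toy setting `Toy.biKummerSetting` of
`Discharge/Sec4NonVacuity.lean` (abc-iut-w5-d063, p418516) satisfies every axiom of abc-iut-L2-t3's
`BiKummerSetting` (monoid type `ℤ`, `Φ` perfect, `A_⊙` Frobenius-trivial and Galois, …), is built through
the canonical model constructor `mkOfModelCanonical`, has `Φ` divisorial and `B` group-like ([FrdI] Thm 5.2
standing hypotheses) and is even a Frobenioid (`Toy.temperedFrobenioidQ_isFrobenioid`, p418792) — and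
yet the typed statement `Prop42_iii` (for the genuine transport `pullFracModel`) FAILS there:

* `Toy.not_prop42_iii` — the fraction-pair `((1, id, 𝔭, u), id)` of the rational function `u = (1, 𝔭)`
  (the "uniformiser": `B ≅ ℤ`) on `A_⊙` has NO square root: the only base object is `∗`, so the `N`-domain
  of any root lies over `∗`, the transport `((α')^birat)^*` is the identity on the `ℤ`-component, and
  `2·b = 1` has no solution in `ℤ`.

Consequently Prop 4.2 (iii) is NOT a consequence of {`BiKummerSetting` axioms, canonical model structure,
`Φ` divisorial & perfect, `B` group-like, `C` a Frobenioid}: any discharge must use an input the toy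
lacks — coverings of the base with enough roots, i.e. exactly sub-node L01a (and the saturation
refinement L01b).  This is a statement about the TYPED sub-DAG (which inputs are essential), kernel-checked;
it refutes nothing in [EtTh].  HONEST LIMITS: toy = one-object base, trivial [FrdI] vocabularies.
Nothing here bears on, or takes a side on, [IUTchIII] Cor. 3.12.
-/

noncomputable section

namespace Literature.AnabelianGeometry.EtaleTheta

open CategoryTheory Opposite Literature.AlgebraicGeometry.Frobenioids
open scoped NNRat

namespace Toy

/-- The `ℤ`-component (`B₀^Λ = ℤ` part) of a rational function of the toy is unchanged by pull-back
along any morphism of the model Frobenioid (the base has one object and `B₀^Λ` is a constant functor).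
[cite: MochizukiEtTh2009, Def 3.6 p.77] -/
theorem pullFracModel_fst {A A' : temperedFrobenioidQ.category} (φ : A' ⟶ A)
    (f : temperedFrobenioidQ.biratUnitsModel A) :
    ((temperedFrobenioidQ.pullFracModel φ f : temperedFrobenioidQ.biratUnitsModel A') :
        temperedFrobenioidQ.ratFnFunctor.obj (op A'.base)).1.1 =
      (f : temperedFrobenioidQ.ratFnFunctor.obj (op A.base)).1.1 := by
  rw [TemperedFrobenioid.coe_pullFracModel_apply]
  rfl

/-- **[EtTh] Prop 4.2 (iii) FAILS at the toy setting** (for the genuine transport `pullFracModel`): the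
fraction-pair `((1, id, 𝔭, u), id)` for the uniformiser `u = (1, 𝔭) ∈ B(∗)^× ≅ ℤ` admits no square root,
since every object lies over the single base object and `2·b = 1` is insoluble in `ℤ`.  Hence the typed
`Prop42_iii` is independent of the `BiKummerSetting` axioms (+ canonical model, `Φ` divisorial/perfect,
`B` group-like, `C` Frobenioid): the covering step L01a of the sub-DAG is essential.
[cite: MochizukiEtTh2009, Prop 4.2 p.88] -/
theorem not_prop42_iii :
    ¬ biKummerSetting.Prop42_iii fun {_ _} φ => temperedFrobenioidQ.pullFracModel φ := by
  intro h
  -- the uniformiser `u = (1, 𝔭)` as an element of the rational function monoid `B(∗)`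
  let z : temperedFrobenioidQ.divisorMonoid.obj (op Aodot.base) := ⟨Multiplicative.ofAdd (1 : ℚ≥0), trivial⟩
  have hz : realifiedQ.divΛ (temperedFrobenioidQ.baseOp (op Aodot.base)) (Multiplicative.ofAdd (1 : ℤ)) =
      temperedFrobenioidQ.ΦgpToRlog (op Aodot.base) (Algebra.GrothendieckGroup.of z) := by
    change divHomQ (Multiplicative.ofAdd 1) = gpMap _ (Algebra.GrothendieckGroup.of z)
    rw [divHomQ_ofAdd_one, gpMap_of]
    rfl
  let p : temperedFrobenioidQ.ratFn (op Aodot.base) :=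
    ⟨(Multiplicative.ofAdd (1 : ℤ), Algebra.GrothendieckGroup.of z), hz⟩
  have hpu : IsUnit (p : temperedFrobenioidQ.ratFnFunctor.obj (op Aodot.base)) :=
    temperedFrobenioidQ.isUnit_ratFnFunctor realifiedQ.isUnit_BΛ Aodot p
  -- the pre-step `s' = (1, id, 𝔭, u) : A_⊙ → A_⊙`
  have hrel : Aodot.cls ^ ((1 : ℕ+) : ℕ) * Algebra.GrothendieckGroup.of z =
      pullGp temperedFrobenioidQ.divisorMonoid (𝟙 Aodot.base) Aodot.cls *
        divB temperedFrobenioidQ.divisorMonoid temperedFrobenioidQ.ratFnFunctor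
          temperedFrobenioidQ.divBNatTrans (op Aodot.base) p := by
    change (1 : Algebra.GrothendieckGroup _) ^ ((1 : ℕ+) : ℕ) * Algebra.GrothendieckGroup.of z =
      pullGp temperedFrobenioidQ.divisorMonoid (𝟙 Aodot.base) 1 * Algebra.GrothendieckGroup.of z
    rw [one_pow, map_one]
  let s' : Aodot ⟶ Aodot := ModelFrobenioid.mkHom Aodot Aodot 1 (𝟙 _) z p hrel
  have hs' : biKummerSetting.IsPreStep s' := ⟨rfl, show IsIso (𝟙 Aodot.base) from inferInstance⟩
  -- the fraction-pair `(s', id)` for `f := s' · id⁻¹`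
  let f : temperedFrobenioidQ.biratUnitsModel Aodot :=
    temperedFrobenioidQ.fracOfModel realifiedQ.isUnit_BΛ s' (𝟙 Aodot)
  have hP : biKummerSetting.FractionPair (A := Aodot) f Aodot :=
    { num := s'
      den := 𝟙 _
      isPreStep_num := hs'
      isPreStep_den := ModelFrobenioid.isPreStep_id _
      base_eq := rfl
      frac_eq := rfl
      disjointSupports := fun x _ hx =>
        (divisorMonoidQ_isDivisorial (Discrete.mk PUnit.unit)).isSharp.eq_one_of_isUnit x
          (isUnit_of_dvd_one hx) }
  -- a square root would solve `2·b = 1` in `ℤ`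
  obtain ⟨R⟩ := h f hP 2
  -- the `ℤ`-component as a homomorphism on `O^×(A^birat) = B(A_D)^×`
  let π : ∀ A : temperedFrobenioidQ.category, temperedFrobenioidQ.biratUnitsModel A →* Multiplicative ℤ :=
    fun A => (MonoidHom.fst _ _).comp
      ((temperedFrobenioidQ.ratFn (op A.base)).subtype.comp (Units.coeHom _))
  have hπpull : ∀ {A A' : temperedFrobenioidQ.category} (φ : A' ⟶ A)
      (g : temperedFrobenioidQ.biratUnitsModel A), π A' (temperedFrobenioidQ.pullFracModel φ g) = π A g :=
    fun φ g => pullFracModel_fst φ g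
  have h1 : (temperedFrobenioidQ.isUnit_ratFnFunctor realifiedQ.isUnit_BΛ Aodot
      (ModelFrobenioid.unit (𝟙 Aodot))).unit = 1 :=
    Units.ext (by rw [IsUnit.unit_spec, ModelFrobenioid.unit_id, Units.val_one])
  have hval : (f : temperedFrobenioidQ.ratFnFunctor.obj (op Aodot.base)) = (p : _) := by
    simp only [f]
    rw [TemperedFrobenioid.coe_fracOfModel, h1, inv_one, Units.val_one, mul_one]
    rfl
  have hπf : π Aodot f = Multiplicative.ofAdd (1 : ℤ) := by
    change (Units.val f).1.1 = _
    rw [hval]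
    rfl
  have hsq : (π R.AN R.root) ^ (2 : ℕ) = Multiplicative.ofAdd (1 : ℤ) :=
    ((map_pow (π R.AN) R.root 2).symm.trans (congrArg (π R.AN) R.pow_root)).trans
      ((hπpull R.αData.α₁ f).trans hπf)
  have h2 := congrArg Multiplicative.toAdd hsq
  rw [toAdd_pow, toAdd_ofAdd, nsmul_eq_mul] at h2
  omega

/-- **Independence of Prop 4.2 (iii) from the §4 setting, packaged**: the toy setting is a Frobenioid
(`Φ` divisorial, `B` group-like, built through `mkOfModelCanonical`) AND the typed `Prop42_iii` for the
genuine transport is FALSE there — so the sub-DAG's covering input L01a cannot be eliminated.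
[cite: MochizukiEtTh2009, Prop 4.2 p.88] -/
theorem isFrobenioid_and_not_prop42_iii :
    PreFrobenioid.IsFrobenioid temperedFrobenioidQ.toElem ∧
      ¬ biKummerSetting.Prop42_iii fun {_ _} φ => temperedFrobenioidQ.pullFracModel φ :=
  ⟨temperedFrobenioidQ_isFrobenioid, not_prop42_iii⟩

end Toy

end Literature.AnabelianGeometry.EtaleTheta

end
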